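import Summits.Ventures.LatticeQCDFlow.Scoring.U1TorusTopologicalSusceptibilityBessel
import Summits.Ventures.LatticeQCDFlow.Scoring.U1IncompleteBesselSeries
import HarnessLib

/-!
# `⟨Q²⟩ = V/12 + V·(2K − (V−1)Σ)/(4π² Z)`: the topological susceptibility of 2-d `U(1)` as a ratio of Bessel series

HONEST FRAMING: exact (Metropolis-corrected) sampling algorithms for lattice gauge theory;
figures of merit are autocorrelation/cost numbers at stated couplings and volumes; no
continuum-physics claim.

Venture `LatticeQCDFlow` (cell pub-lqcd), sub-topic `Scoring`; FANOUT row 5 (`s0-sun-a`), GEN-14.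
NEW WORK of the cell (placement rule).  `Scoring/U1TorusTopologicalSusceptibilityBessel.lean` gives
`⟨Q²⟩_{(ℤ/L)²,β} = (V/(16π⁴)) Σ_n [2π I_{|n|}^{V−1} c_n − (V−1) I_{|n|}^{V−2} s_n²] / Σ_n I_{|n|}^V` with the
incomplete Bessel integrals `s_n`, `c_n`; `Scoring/U1IncompleteBesselSeries.lean` writes those as Bessel
series, `s_n = −2π σ_n`, `c_n = (2π³/3) I_{|n|} + 4π κ_n`,

  `σ_n(β) = Σ_{m∈ℤ} (−1)^{n+m} I_{|m|}(β)/(n+m)`,  `κ_n(β) = Σ_{m∈ℤ} (−1)^{n+m} I_{|m|}(β)/(n+m)²`.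

Substituting (`π` drops out of everything but one factor `1/(4π²)`):

* **`integral_topCharge_sq_eq_twelfth_add`** — for every `L ≥ 2` and real `β`, `V = L²`,
  `⟨Q²⟩_{(ℤ/L)²,β} = V/12 + (V/(4π²)) · Σ_n [2 I_{|n|}^{V−1} κ_n − (V−1) I_{|n|}^{V−2} σ_n²] / Σ_n I_{|n|}^V`;
* **`u1TopSusceptibility_eq_twelfth_add`** — `χ_t = 1/12 + (1/(4π²)) · (same ratio)`.

`V/12` is the second moment of the sum of `V` independent uniform angles (in units of `2π`)
conditioned to close up — the value at `β = 0`, where every `I_{|m|}(0)` with `m ≠ 0` vanishes and the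
correction series is `0`; the correction carries the whole `β`-dependence and is an absolutely
convergent double Bessel series with RATIONAL coefficients — the form the kernel-checked enclosures
at the cell's `U(1)` keys evaluate.  Elementary given the parents; nothing is cited.
-/

noncomputable section

open MeasureTheory Set Real Filter Topology Finset
open scoped ENNReal
open Literature.Analysis.FunctionSpaces
open Literature.MathematicalPhysics.QuantumFieldTheory
open Literature.MathematicalPhysics.QuantumLattice (u1Rep)
open Summit.Ventures.LatticeQCDFlow.Theory2.Lattice (topCharge)

namespace Summit.Ventures.LatticeQCDFlow.Scoring

variable (β : ℝ)

/-! ### 1. Bounds and summability -/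

/-- `|I_{|n|}(β)| ≤ I₀(|β|)`. -/
theorem abs_besselI_natAbs_le (n : ℤ) : |besselI n.natAbs β| ≤ besselI 0 |β| := by
  rw [abs_besselI_eq_besselI_abs]; exact besselI_le_besselI_zero _ _

/-- `Σ_m |I_{|m|}(β)| · 1 ≥ |Σ_m I_{|m|}(β) a_m|` for `|a_m| ≤ 1`: the series `σ_n`, `κ_n` are bounded by
`e^{|β|}` uniformly in `n`. -/
theorem abs_tsum_besselI_natAbs_mul_le {a : ℤ → ℝ} (ha : ∀ m, |a m| ≤ 1) :
    |∑' m : ℤ, besselI m.natAbs β * a m| ≤ Real.exp |β| := by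
  have hs : Summable fun m : ℤ => ‖besselI m.natAbs β * a m‖ := by
    refine Summable.of_nonneg_of_le (fun _ => norm_nonneg _) (fun m => ?_) (summable_besselI_natAbs |β|)
    rw [Real.norm_eq_abs, abs_mul, abs_besselI_eq_besselI_abs]
    exact mul_le_of_le_one_right (besselI_nonneg _ (abs_nonneg β)) (ha m)
  rw [← Real.norm_eq_abs]
  refine (norm_tsum_le_tsum_norm hs).trans ?_
  rw [← (hasSum_besselI_natAbs |β|).tsum_eq]
  refine Summable.tsum_le_tsum (fun m => ?_) hs (summable_besselI_natAbs |β|)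
  rw [Real.norm_eq_abs, abs_mul, abs_besselI_eq_besselI_abs]
  exact mul_le_of_le_one_right (besselI_nonneg _ (abs_nonneg β)) (ha m)

/-- `|σ_n(β)| ≤ e^{|β|}`. -/
theorem abs_sigmaSeries_le (n : ℤ) :
    |∑' m : ℤ, besselI m.natAbs β * ((-1 : ℝ) ^ (n + m) / (n + m : ℤ))| ≤ Real.exp |β| :=
  abs_tsum_besselI_natAbs_mul_le β fun m => abs_neg_one_zpow_div_le (n + m)

/-- `|κ_n(β)| ≤ e^{|β|}`. -/
theorem abs_kappaSeries_le (n : ℤ) :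
    |∑' m : ℤ, besselI m.natAbs β * ((-1 : ℝ) ^ (n + m) / ((n + m : ℤ) : ℝ) ^ 2)| ≤ Real.exp |β| :=
  abs_tsum_besselI_natAbs_mul_le β fun m => abs_neg_one_zpow_div_sq_le (n + m)

/-- `Σ_n I_{|n|}(β)^{k+1}` is summable for every real `β`. -/
theorem summable_besselI_natAbs_pow_succ (k : ℕ) : Summable fun n : ℤ => besselI n.natAbs β ^ (k + 1) := by
  refine Summable.of_norm_bounded ((summable_besselI_natAbs |β|).mul_left (besselI 0 |β| ^ k))
    fun n => ?_
  rw [Real.norm_eq_abs, abs_pow, pow_succ, ← abs_besselI_eq_besselI_abs n.natAbs β]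
  exact mul_le_mul_of_nonneg_right (pow_le_pow_left₀ (abs_nonneg _) (abs_besselI_natAbs_le β n) k)
    (abs_nonneg _)

/-- The correction summand `2 I_{|n|}^{m+2} κ_n − (m+2) I_{|n|}^{m+1} σ_n²` is absolutely summable
(`V = m + 3`). -/
theorem summable_correction_term (m : ℕ) :
    Summable fun n : ℤ =>
      2 * besselI n.natAbs β ^ (m + 2) *
          (∑' k : ℤ, besselI k.natAbs β * ((-1 : ℝ) ^ (n + k) / ((n + k : ℤ) : ℝ) ^ 2)) -
        (m + 2 : ℕ) * besselI n.natAbs β ^ (m + 1) *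
          (∑' k : ℤ, besselI k.natAbs β * ((-1 : ℝ) ^ (n + k) / (n + k : ℤ))) ^ 2 := by
  set A : ℝ := besselI 0 |β| with hA
  set E : ℝ := Real.exp |β| with hE
  set K : ℝ := 2 * A ^ (m + 1) * E + (m + 2 : ℕ) * A ^ m * E ^ 2 with hK
  refine Summable.of_norm_bounded ((summable_besselI_natAbs |β|).mul_left K) fun n => ?_
  set x : ℝ := besselI n.natAbs β with hx
  set κ : ℝ := ∑' k : ℤ, besselI k.natAbs β * ((-1 : ℝ) ^ (n + k) / ((n + k : ℤ) : ℝ) ^ 2) with hκ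
  set σ : ℝ := ∑' k : ℤ, besselI k.natAbs β * ((-1 : ℝ) ^ (n + k) / (n + k : ℤ)) with hσ
  have hxabs : |x| = besselI n.natAbs |β| := abs_besselI_eq_besselI_abs _ _
  have hxA : |x| ≤ A := abs_besselI_natAbs_le β n
  have hκE : |κ| ≤ E := abs_kappaSeries_le β n
  have hσE : |σ| ≤ E := abs_sigmaSeries_le β n
  have hx0 : 0 ≤ |x| := abs_nonneg _
  have hE0 : 0 ≤ E := (Real.exp_pos _).le
  have hA0 : 0 ≤ A := hx0.trans hxA
  have h1 : |2 * x ^ (m + 2) * κ| ≤ 2 * A ^ (m + 1) * E * |x| := by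
    rw [abs_mul, abs_mul, abs_two, abs_pow, pow_succ]
    have hp : |x| ^ (m + 1) ≤ A ^ (m + 1) := pow_le_pow_left₀ hx0 hxA (m + 1)
    calc 2 * (|x| ^ (m + 1) * |x|) * |κ| ≤ 2 * (A ^ (m + 1) * |x|) * E :=
          mul_le_mul (mul_le_mul_of_nonneg_left (mul_le_mul_of_nonneg_right hp hx0) zero_le_two)
            hκE (abs_nonneg _) (mul_nonneg zero_le_two (mul_nonneg (pow_nonneg hA0 _) hx0))
      _ = 2 * A ^ (m + 1) * E * |x| := by ring
  have h2 : |((m + 2 : ℕ) : ℝ) * x ^ (m + 1) * σ ^ 2| ≤ (m + 2 : ℕ) * A ^ m * E ^ 2 * |x| := by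
    rw [abs_mul, abs_mul, Nat.abs_cast, abs_pow, abs_pow, pow_succ]
    have hp : |x| ^ m ≤ A ^ m := pow_le_pow_left₀ hx0 hxA m
    have hs : |σ| ^ 2 ≤ E ^ 2 := pow_le_pow_left₀ (abs_nonneg _) hσE 2
    calc ((m + 2 : ℕ) : ℝ) * (|x| ^ m * |x|) * |σ| ^ 2
        ≤ ((m + 2 : ℕ) : ℝ) * (A ^ m * |x|) * E ^ 2 :=
          mul_le_mul (mul_le_mul_of_nonneg_left (mul_le_mul_of_nonneg_right hp hx0) (Nat.cast_nonneg _))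
            hs (pow_nonneg (abs_nonneg _) 2)
            (mul_nonneg (Nat.cast_nonneg _) (mul_nonneg (pow_nonneg hA0 _) hx0))
      _ = (m + 2 : ℕ) * A ^ m * E ^ 2 * |x| := by ring
  rw [Real.norm_eq_abs, ← hxabs, hK]
  calc |2 * x ^ (m + 2) * κ - ((m + 2 : ℕ) : ℝ) * x ^ (m + 1) * σ ^ 2|
      ≤ 2 * A ^ (m + 1) * E * |x| + (m + 2 : ℕ) * A ^ m * E ^ 2 * |x| :=
        (abs_sub _ _).trans (add_le_add h1 h2)
    _ = (2 * A ^ (m + 1) * E + (m + 2 : ℕ) * A ^ m * E ^ 2) * |x| := by ring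

/-! ### 2. The numerator series, term by term -/

/-- **Term by term**: `2π I^{m+2} c_n − (m+2) I^{m+1} s_n² = (4π⁴/3) I^{m+3} + 4π² [2 I^{m+2} κ_n − (m+2) I^{m+1} σ_n²]`. -/
theorem numerator_term_eq (m : ℕ) (n : ℤ) :
    2 * π * besselI n.natAbs β ^ (m + 2) *
          (∫ v in (-π)..π, v ^ 2 * Real.cos (n * v) * Real.exp (β * Real.cos v)) -
        (m + 2 : ℕ) * besselI n.natAbs β ^ (m + 1) *
          (∫ v in (-π)..π, v * Real.sin (n * v) * Real.exp (β * Real.cos v)) ^ 2 =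
      4 * π ^ 4 / 3 * besselI n.natAbs β ^ (m + 3) + 4 * π ^ 2 *
        (2 * besselI n.natAbs β ^ (m + 2) *
            (∑' k : ℤ, besselI k.natAbs β * ((-1 : ℝ) ^ (n + k) / ((n + k : ℤ) : ℝ) ^ 2)) -
          (m + 2 : ℕ) * besselI n.natAbs β ^ (m + 1) *
            (∑' k : ℤ, besselI k.natAbs β * ((-1 : ℝ) ^ (n + k) / (n + k : ℤ))) ^ 2) := by
  rw [cosMoment_eq_tsum, sinMoment_eq_tsum]
  ring

/-- **The numerator series**: with `Z = Σ_n I_{|n|}^{m+3}` and the correction series `M`,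
`Σ_n [2π I^{m+2} c_n − (m+2) I^{m+1} s_n²] = (4π⁴/3) Z + 4π² M`. -/
theorem numerator_tsum_eq (m : ℕ) :
    ∑' n : ℤ, (2 * π * besselI n.natAbs β ^ (m + 2) *
          (∫ v in (-π)..π, v ^ 2 * Real.cos (n * v) * Real.exp (β * Real.cos v)) -
        (m + 2 : ℕ) * besselI n.natAbs β ^ (m + 1) *
          (∫ v in (-π)..π, v * Real.sin (n * v) * Real.exp (β * Real.cos v)) ^ 2) =
      4 * π ^ 4 / 3 * ∑' n : ℤ, besselI n.natAbs β ^ (m + 3) + 4 * π ^ 2 * ∑' n : ℤ,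
        (2 * besselI n.natAbs β ^ (m + 2) *
            (∑' k : ℤ, besselI k.natAbs β * ((-1 : ℝ) ^ (n + k) / ((n + k : ℤ) : ℝ) ^ 2)) -
          (m + 2 : ℕ) * besselI n.natAbs β ^ (m + 1) *
            (∑' k : ℤ, besselI k.natAbs β * ((-1 : ℝ) ^ (n + k) / (n + k : ℤ))) ^ 2) := by
  simp_rw [numerator_term_eq]
  rw [Summable.tsum_add ((summable_besselI_natAbs_pow_succ β (m + 2)).mul_left _)
    ((summable_correction_term β m).mul_left _), tsum_mul_left, tsum_mul_left]

/-! ### 3. `⟨Q²⟩ = V/12 + correction` -/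

variable {L : ℕ} [NeZero L]

/-- **`⟨Q²⟩ = V/12 + V·M/(4π² Z)`.**  For every `L ≥ 2` and every real `β`, `V = L²`:

  `∫ Q² dμ_{(ℤ/L)²,β} = V/12 + (V/(4π²)) · (Σ_n [2 I_{|n|}^{V−1} κ_n − (V−1) I_{|n|}^{V−2} σ_n²]) / Σ_n I_{|n|}^V`,

`σ_n = Σ_m (−1)^{n+m} I_{|m|}(β)/(n+m)`, `κ_n = Σ_m (−1)^{n+m} I_{|m|}(β)/(n+m)²` (all `I = I(β)`). -/
theorem integral_topCharge_sq_eq_twelfth_add (hL : 2 ≤ L) :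
    ∫ U, (topCharge U) ^ 2 ∂(wilsonMeasure (d := 2) (L := L) u1Rep β) =
      (L : ℝ) ^ 2 / 12 + (L : ℝ) ^ 2 / (4 * π ^ 2) *
        (∑' n : ℤ, (2 * besselI n.natAbs β ^ (L ^ 2 - 1) *
            (∑' k : ℤ, besselI k.natAbs β * ((-1 : ℝ) ^ (n + k) / ((n + k : ℤ) : ℝ) ^ 2)) -
          (L ^ 2 - 1 : ℕ) * besselI n.natAbs β ^ (L ^ 2 - 2) *
            (∑' k : ℤ, besselI k.natAbs β * ((-1 : ℝ) ^ (n + k) / (n + k : ℤ))) ^ 2)) /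
        ∑' n : ℤ, besselI n.natAbs β ^ (L ^ 2) := by
  have hV : 3 ≤ L ^ 2 := le_trans (by norm_num) (Nat.pow_le_pow_left hL 2)
  obtain ⟨m, hm⟩ := Nat.exists_eq_add_of_le' hV
  have hZ := tsum_besselI_natAbs_pow_sq_pos β hL
  have hπ : (π : ℝ) ≠ 0 := Real.pi_pos.ne'
  rw [integral_topCharge_sq_eq_besselI β hL]
  rw [hm] at hZ ⊢
  rw [show m + 3 - 1 = m + 2 from rfl, show m + 3 - 2 = m + 1 from rfl, numerator_tsum_eq]
  field_simp
  ring

/-- **`χ_t = 1/12 + M/(4π² Z)`** — the topological susceptibility of 2-d `U(1)` on the `L × L` torus,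
`L ≥ 2`, every real `β`, as `1/12` plus a ratio of absolutely convergent Bessel series with rational
coefficients. -/
theorem u1TopSusceptibility_eq_twelfth_add (hL : 2 ≤ L) :
    u1TopSusceptibility L β =
      1 / 12 + 1 / (4 * π ^ 2) *
        (∑' n : ℤ, (2 * besselI n.natAbs β ^ (L ^ 2 - 1) *
            (∑' k : ℤ, besselI k.natAbs β * ((-1 : ℝ) ^ (n + k) / ((n + k : ℤ) : ℝ) ^ 2)) -
          (L ^ 2 - 1 : ℕ) * besselI n.natAbs β ^ (L ^ 2 - 2) *
            (∑' k : ℤ, besselI k.natAbs β * ((-1 : ℝ) ^ (n + k) / (n + k : ℤ))) ^ 2)) /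
        ∑' n : ℤ, besselI n.natAbs β ^ (L ^ 2) := by
  have hL0 : (L : ℝ) ^ 2 ≠ 0 := by
    have : (0 : ℝ) < L := by exact_mod_cast Nat.pos_of_ne_zero (NeZero.ne L)
    positivity
  rw [u1TopSusceptibility, integral_topCharge_sq_eq_twelfth_add β hL]
  field_simp

end Summit.Ventures.LatticeQCDFlow.Scoring
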